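import Summits.BirchSwinnertonDyer.Rank1Residual.ManinAdditive.MinusOneLevelRaisingGeneralProof
import Summits.BirchSwinnertonDyer.Rank1Residual.ManinAdditive.MinusOneLevelRaisingManinOddAtFourSplit
import Summits.BirchSwinnertonDyer.BirchSwinnertonDyer.Theses.ManinLocalTwoThree
import Literature.NumberTheory.EllipticCurves.CuspFormLFunctionLevelConductorProofs
import HarnessLib

/-!
# THE GENERAL `χ₋₄` ROTATION LAW — PART B5b: the general optimal-partner construction (S-an-60/61) and the ROUTE CRUX
# reduced to `16 ∣ N` (`ManinOddAtFour ⟸ ManinOddAtSixteen ∧ S-an-58 ∧ S-an-60`) (cell bsd-f2-manin, -an g32, MEMO-an §75.10)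

TYPER NOTE (typer g17, TURNKEY-an-25, PART B5b = 2/3).  §9 `GeneralPartner` and §9bis `SplitSixteen` of an's
HOME/an/g32/MinusOneLevelRaisingGeneralProof.lean 57aa2c9e76daaa63 VERBATIM (see PART B5a `MinusOneLevelRaisingGeneralProof.lean`
for the full header, census and the split rationale), except the Barrios `[cite:]` key (`BarriosEtAl2025`).  THREE new
`def … : Prop`, statement-only: **S-an-60 `NegOneTwistConductorTwoMul`** (print fact per an: `f₂ = 3 ⇒ N(W ⊗ χ₋₄) = 2N`;
census 168 136 / 168 136; node, explicit hypothesis — not vendored as a Literature fact: p2 g13 PROVED S-an-58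
(`ManinLocalTwoThree.negOneTwistConductorFourMul_holds`, p695186/p696508) and is proving S-an-60 the same way (Tate over ℤ₂)), **S-an-61 `MinusOneLevelRaisingByTwoOptimalPartner`** (discharged here modulo `exists_isNewformOf`
+ S-an-60: `minusOneLevelRaisingByTwoOptimalPartner_of`), **S-an-62 `ManinOddAtSixteen`** (= the crux C2 with `2 ^ 4 ∣ N`; OPEN,
obligation-shaped).  THEOREMS: `exists_optimalPartner_general` (an's re-derivation `minusOneLevelRaisingOptimalPartner_of'` omitted, dedup),
`two_not_dvd_c_of_eight_dvd_of_sixteen_dvd_stratum_of_modularity`, `two_not_dvd_c_of_four_dvd_of_sixteen_dvd_stratum_of_modularity`,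
`maninOddAtEight_of_maninOddAtSixteen`, **`maninOddAtFour_of_maninOddAtSixteen : NegOneTwistConductorFourMul →
NegOneTwistConductorTwoMul → ManinOddAtSixteen → Theses.ManinLocalTwoThree.ManinOddAtFour`**, `maninOddAtSixteen_of_maninOddAtFour`.
The ROUTE-LEVEL split is the C2 LEAD's call and is not performed here.  PARTITION 0 · C2 is NOT proved (`ManinOddAtSixteen`
is open) · BSD is not proved by this; Manin's conjecture is not proved by this.
-/

set_option autoImplicit false

noncomputable section

open scoped MatrixGroups ModularForm
open CongruenceSubgroup WeierstrassCurve
  Literature.NumberTheory.DiophantineGeometry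
  Literature.NumberTheory.EllipticCurves
  Literature.NumberTheory.EllipticCurves.ModularForms
  Summit.BirchSwinnertonDyer.BirchSwinnertonDyer.Theorems

namespace Summit.BirchSwinnertonDyer.Rank1Residual.ManinAdditive

section GeneralPartner

/-- **Candidate S-an-60 `NegOneTwistConductorTwoMul` (print fact; nothing asserted).** If `8 ∥ N(W)` (`f₂ = 3`:
potentially good, wild with Swan conductor `1`, all slopes `< 1`), then `N(W ⊗ χ₋₄) = 2·N(W)` (`f₂ = 4`): `χ₋₄` has the
single slope `1`, so every slope of `ρ ⊗ χ₋₄` is `1`, `sw = 2`, `a = 2 + 2 = 4`; odd places unchanged.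
Census: all 168 136 classes with `v₂(N) = 3`, `N ≤ 500 000` have `N(E ⊗ χ₋₄) = 2N` (TWISTCENSUS2 pattern `(3,4)`).
[cite: Serre1987, §4] [cite: Katz1988, 1.1–1.9 (slopes of a tensor product)] [cite: BarriosEtAl2025, Thm. 5.1, Table (v(d) = 0) rows with f = 3, d ≡ 3 (mod 4): (f, f^d) = (3, 4)] -/
def NegOneTwistConductorTwoMul : Prop :=
  ∀ (W : WeierstrassCurve ℚ) [W.IsElliptic],
    2 ^ 3 ∣ W.conductorNorm ℤ → ¬ 2 ^ 4 ∣ W.conductorNorm ℤ →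
    (haveI := W.isElliptic_quadraticTwist (show ((-1 : ℤ) : ℚ) ≠ 0 by norm_num);
      (W.quadraticTwist ((-1 : ℤ) : ℚ)).conductorNorm ℤ) = 2 * W.conductorNorm ℤ


/-- **GENERAL OPTIMAL PARTNER CONSTRUCTION (mod modularity).** `W` minimal, `D` lattice-optimal at `N(W)`,
`4 ∣ N(W)`; if `N(W ⊗ χ₋₄) = m·N(W)` with `m ∣ 4` and `16 ∣ m·N(W)`, then the minimal model `W′` of `W ⊗ χ₋₄`
carries a LATTICE-OPTIMAL `Γ₀(N(W′))`-datum with the SAME constant `c′ = c`.  (`m = 4`: S-an-57, §7; `m = 2`: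
the `8 ∥ N` partner below; `m = 1`: the same-level partner at `16 ∣ N`.)  Proof = §7 verbatim over the general
two-sided step. [cite: Pal2012, Lemma 3.1 and Prop. 2.4] [cite: Stevens1989, Lemma (5.4) p. 97] -/
theorem exists_optimalPartner_general (hnf : exists_isNewformOf)
    (W : WeierstrassCurve ℚ) [W.IsElliptic] [W.IsGloballyMinimal] [NeZero (W.conductorNorm ℤ)]
    (D : ModularParametrizationData W (W.conductorNorm ℤ)) (hD : IsLatticeOptimal D)
    (h4 : 2 ^ 2 ∣ W.conductorNorm ℤ) (m : ℕ) (hm4 : m ∣ 4) (h16 : 4 ^ 2 ∣ m * W.conductorNorm ℤ)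
    (hNT0 : (haveI := W.isElliptic_quadraticTwist (show ((-1 : ℤ) : ℚ) ≠ 0 by norm_num);
      (W.quadraticTwist ((-1 : ℤ) : ℚ)).conductorNorm ℤ) = m * W.conductorNorm ℤ) :
    ∃ (W' : WeierstrassCurve ℚ) (_ : W'.IsElliptic) (_ : W'.IsGloballyMinimal)
      (_ : NeZero (W'.conductorNorm ℤ)) (D' : ModularParametrizationData W' (W'.conductorNorm ℤ)),
      IsLatticeOptimal D' ∧ W'.conductorNorm ℤ = m * W.conductorNorm ℤ ∧
      IsIsogenous (W.quadraticTwist ((-1 : ℤ) : ℚ)) W' ∧ D'.c = D.c := by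
  have hm0 : m ≠ 0 := by
    rintro rfl; exact absurd (zero_dvd_iff.mp hm4) (by norm_num)
  have hd0 : ((-1 : ℤ) : ℚ) ≠ 0 := by norm_num
  haveI := W.isElliptic_quadraticTwist hd0
  set T := W.quadraticTwist ((-1 : ℤ) : ℚ) with hT
  have hNT : T.conductorNorm ℤ = m * W.conductorNorm ℤ := hNT0
  -- the minimal model `W′ = C • T`, `u(C)² = 1`
  obtain ⟨C, hmin⟩ := hasGlobalMinimalModel_rat_holds T
  haveI := hmin
  have hNW' : (C • T).conductorNorm ℤ = m * W.conductorNorm ℤ := by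
    rw [WeierstrassCurve.conductorNorm_smul]; exact hNT
  haveI : NeZero ((C • T).conductorNorm ℤ) :=
    ⟨by rw [hNW']; exact mul_ne_zero hm0 (NeZero.ne _)⟩
  have hM'' : 4 ^ 2 ∣ (C • T).conductorNorm ℤ := by rw [hNW']; exact h16
  have h4' : 2 ^ 2 ∣ (C • T).conductorNorm ℤ := dvd_trans ⟨4, by norm_num⟩ hM''
  have hNdvd : W.conductorNorm ℤ ∣ (C • T).conductorNorm ℤ := by rw [hNW']; exact Dvd.intro_left m rfl
  have hL : (C • T).conductorNorm ℤ ∣ 4 * W.conductorNorm ℤ := by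
    obtain ⟨k, hk⟩ := hm4
    rw [hNW', hk]
    exact ⟨k, by ring⟩
  have hΔ : (C • T).Δ = W.Δ := negOneTwistMinimalDiscrEq_holds W (C • T) C h4 h4' rfl
  have hu2 : ((C.u : ℚ)) ^ 2 = 1 :=
    u_sq_eq_one_of_smul_quadraticTwist_of_Δ hd0 C rfl (by rw [hΔ]; norm_num)
  have hu1 : (C.u : ℚ) = 1 ∨ (C.u : ℚ) = -1 := mul_self_eq_one_iff.mp (by rw [← pow_two]; exact hu2)
  -- the newform `g` of `W′` and the two-sided lattice step `Λ(g) = s·Λ(f_W)`, `s = g(χ₄)/2`, `s² = −1`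
  obtain ⟨g, hg⟩ := hnf (C • T)
  have hisoT : IsIsogenous T (C • T) := isIsogenous_smul T C
  obtain ⟨h₁, h₂⟩ := half_gaussSum_χ₄_twoSided_general D g hg h4 hM'' hNdvd hL hisoT
  set s : ℂ := gaussSum (ZMod.χ₄.ringHomComp (Int.castRingHom ℂ)) (ZMod.stdAddChar (N := 4)) / 2
    with hs
  have hs2 : s ^ 2 = -1 := by
    rw [hs, div_pow, gaussSum_χ₄_ringHomComp_sq]; norm_num
  have hs0 : s ≠ 0 := fun h ↦ by rw [h] at hs2; norm_num at hs2
  -- Néron pairs: `Λ(T) = s⁻¹Λ(W)` (Pal), `Λ(W′) = u·Λ(T)`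
  have hs2' : s ^ 2 = ((((-1 : ℤ) : ℚ)) : ℂ) := by rw [hs2]; norm_num
  have hLT : IsNeronLatticeOf (T.baseChange ℂ) (D.L.mulLeft s⁻¹ (inv_ne_zero hs0)) :=
    isNeronLatticeOf_quadraticTwist_of_sq_eq ((-1 : ℤ) : ℚ) D.isNeronLattice hs0 hs2'
  haveI : ((C • T).baseChange ℂ).IsElliptic := by rw [WeierstrassCurve.baseChange]; infer_instance
  obtain ⟨L', hL'⟩ := exists_isNeronLatticeOf_holds ((C • T).baseChange ℂ)
  have hlat := IsNeronLatticeOf.lattice_eq_mulLeft_of_smul C hLT hL'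
  have huC0 : ((C.u : ℚ) : ℂ) ≠ 0 := by exact_mod_cast C.u.ne_zero
  -- membership in `Λ(W′)`: `z ∈ Λ(W′) ↔ s·(u⁻¹ z) ∈ Λ(W)`
  have hmem : ∀ z : ℂ, z ∈ L'.lattice ↔ s * ((((C.u : ℚ) : ℂ))⁻¹ * z) ∈ D.L.lattice := fun z ↦ by
    rw [hlat, PeriodPair.mem_mulLeft_lattice, PeriodPair.mem_mulLeft_lattice, inv_inv]
  -- `ε = u = ±1` acts trivially on every `ℤ`-lattice
  have hεW : ∀ x : ℂ, (((C.u : ℚ) : ℂ))⁻¹ * x ∈ D.L.lattice ↔ x ∈ D.L.lattice := fun x ↦ by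
    rcases hu1 with h | h <;> simp [h, neg_mem_iff]
  have hc0 : D.c ≠ 0 := D.maninConstant_ne_zero_holds
  -- `c·Λ(g) ⊆ Λ(W′)`
  have hc : ∀ z ∈ periodLattice g, (D.c : ℂ) * z ∈ L'.lattice := fun z hz ↦ by
    rw [hmem, ← mul_assoc, mul_comm s, mul_assoc, hεW, ← mul_assoc, mul_comm s, mul_assoc]
    · exact D.smul_periodLattice_le _ (h₁ z hz)
  obtain ⟨D', hf', hL'eq, hc'⟩ :=
    PlusEtaManinInput.exists_modularParametrizationData_eq_of_smul_periodLattice_le hg hL' hc0 hc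
  subst hf' hL'eq
  refine ⟨C • T, inferInstance, hmin, inferInstance, D', ?_, hNW', hisoT, hc'⟩
  -- lattice-optimality of `D′`: `Λ(W′) = c·Λ(g)`
  intro z hz
  rw [hmem, ← mul_assoc, mul_comm s, mul_assoc, hεW] at hz
  obtain ⟨w₀, hw₀, hzw⟩ := hD _ hz
  refine ⟨-(s * w₀), neg_mem (h₂ w₀ hw₀), ?_⟩
  rw [hc']
  have hz' : z = -(s * (s * z)) := by
    rw [← mul_assoc, ← pow_two, hs2]; ring
  rw [hz', hzw]; ring

-- (typer g17: an's `minusOneLevelRaisingOptimalPartner_of'` — S-an-57 re-derived from the general construction with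
-- `m = 4` — is omitted: same statement as the landed B3 `minusOneLevelRaisingOptimalPartner_of`, `dedup.landed`;
-- and since p2's `negOneTwistConductorFourMul_holds` (p696508) the hypothesis-free form is p2's
-- `ManinLocalTwoThree.minusOneLevelRaisingOptimalPartner_of_modularity`.)

/-- **Candidate S-an-61 `MinusOneLevelRaisingByTwoOptimalPartner`** (existence side of E-an-148 at the level of
OPTIMAL curves): every lattice-optimal conductor-level datum with `8 ∥ N` has a lattice-optimal `χ₋₄`-partner
datum at conductor `2N`.  PROVED below modulo modularity from S-an-60. -/
def MinusOneLevelRaisingByTwoOptimalPartner : Prop :=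
  ∀ (W : WeierstrassCurve ℚ) [W.IsElliptic] [W.IsGloballyMinimal] [NeZero (W.conductorNorm ℤ)]
    (D : ModularParametrizationData W (W.conductorNorm ℤ)),
    IsLatticeOptimal D → 2 ^ 3 ∣ W.conductorNorm ℤ → ¬ 2 ^ 4 ∣ W.conductorNorm ℤ →
    ∃ (W' : WeierstrassCurve ℚ) (_ : W'.IsElliptic) (_ : W'.IsGloballyMinimal)
      (_ : NeZero (W'.conductorNorm ℤ)) (D' : ModularParametrizationData W' (W'.conductorNorm ℤ)),
      IsLatticeOptimal D' ∧ W'.conductorNorm ℤ = 2 * W.conductorNorm ℤ ∧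
      IsIsogenous (W.quadraticTwist ((-1 : ℤ) : ℚ)) W'

/-- **S-an-61 PROVED modulo modularity + S-an-60** (`m = 2`). -/
theorem minusOneLevelRaisingByTwoOptimalPartner_of (hnf : exists_isNewformOf)
    (h60 : NegOneTwistConductorTwoMul) : MinusOneLevelRaisingByTwoOptimalPartner := by
  intro W _ _ _ D hD h8 h16
  have h4 : 2 ^ 2 ∣ W.conductorNorm ℤ := dvd_trans ⟨2, by norm_num⟩ h8
  obtain ⟨W', i1, i2, i3, D', hD', hN', hiso, -⟩ := exists_optimalPartner_general hnf W D hD h4 2 ⟨2, rfl⟩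
    (by obtain ⟨k, hk⟩ := h8; exact ⟨k, by rw [hk]; ring⟩) (h60 W h8 h16)
  exact ⟨W', i1, i2, i3, D', hD', hN', hiso⟩

/-- **C2 at the conductor level: the `8 ∥ N` stratum is IMPLIED by the `16 ∣ N` stratum** (mod modularity and
S-an-60): the `χ₋₄`-rotation moves every lattice-optimal datum with `8 ∥ N` to one with `16 ∥ N′ = 2N` and the same
constant. -/
theorem two_not_dvd_c_of_eight_dvd_of_sixteen_dvd_stratum_of_modularity (hnf : exists_isNewformOf)
    (h60 : NegOneTwistConductorTwoMul)
    (h16 : ∀ (W' : WeierstrassCurve ℚ) [W'.IsElliptic] [W'.IsGloballyMinimal] [NeZero (W'.conductorNorm ℤ)]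
      (D' : ModularParametrizationData W' (W'.conductorNorm ℤ)),
      IsLatticeOptimal D' → 2 ^ 4 ∣ W'.conductorNorm ℤ → ¬ (2 : ℤ) ∣ D'.c)
    (W : WeierstrassCurve ℚ) [W.IsElliptic] [W.IsGloballyMinimal] [NeZero (W.conductorNorm ℤ)]
    (D : ModularParametrizationData W (W.conductorNorm ℤ)) (hD : IsLatticeOptimal D)
    (h8 : 2 ^ 3 ∣ W.conductorNorm ℤ) : ¬ (2 : ℤ) ∣ D.c := by
  by_cases h16W : 2 ^ 4 ∣ W.conductorNorm ℤ
  · exact h16 W D hD h16W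
  have h4 : 2 ^ 2 ∣ W.conductorNorm ℤ := dvd_trans ⟨2, by norm_num⟩ h8
  obtain ⟨W', i1, i2, i3, D', hD', hN', -, hc'⟩ := exists_optimalPartner_general hnf W D hD h4 2 ⟨2, rfl⟩
    (by obtain ⟨k, hk⟩ := h8; exact ⟨k, by rw [hk]; ring⟩) (h60 W h8 h16W)
  have h16' : 2 ^ 4 ∣ W'.conductorNorm ℤ := by
    rw [hN']; obtain ⟨k, hk⟩ := h8; exact ⟨k, by rw [hk]; ring⟩
  rw [← hc']
  exact h16 W' D' hD' h16'

/-- **C2 at the conductor level: the whole `4 ∣ N` range is IMPLIED by the `16 ∣ N` stratum** (mod modularity,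
S-an-58 and S-an-60) — §7 and the previous theorem chained. -/
theorem two_not_dvd_c_of_four_dvd_of_sixteen_dvd_stratum_of_modularity (hnf : exists_isNewformOf)
    (h58 : NegOneTwistConductorFourMul) (h60 : NegOneTwistConductorTwoMul)
    (h16 : ∀ (W' : WeierstrassCurve ℚ) [W'.IsElliptic] [W'.IsGloballyMinimal] [NeZero (W'.conductorNorm ℤ)]
      (D' : ModularParametrizationData W' (W'.conductorNorm ℤ)),
      IsLatticeOptimal D' → 2 ^ 4 ∣ W'.conductorNorm ℤ → ¬ (2 : ℤ) ∣ D'.c)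
    (W : WeierstrassCurve ℚ) [W.IsElliptic] [W.IsGloballyMinimal] [NeZero (W.conductorNorm ℤ)]
    (D : ModularParametrizationData W (W.conductorNorm ℤ)) (hD : IsLatticeOptimal D)
    (h4 : 2 ^ 2 ∣ W.conductorNorm ℤ) : ¬ (2 : ℤ) ∣ D.c :=
  two_not_dvd_c_of_four_dvd_of_eight_dvd_stratum_of_modularity hnf h58
    (fun W' _ _ _ D' hD' h8' ↦
      two_not_dvd_c_of_eight_dvd_of_sixteen_dvd_stratum_of_modularity hnf h60 h16 W' D' hD' h8')
    W D hD h4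

end GeneralPartner

/-! ## §9bis THE ROUTE CRUX REDUCED TO `16 ∣ N`: `ManinOddAtFour ⟸ ManinOddAtSixteen ∧ S-an-58 ∧ S-an-60` -/

section SplitSixteen

/-- **Candidate S-an-62 `ManinOddAtSixteen`**: the route crux C2 `ManinOddAtFour` VERBATIM with `2 ^ 2 ∣ N`
replaced by `2 ^ 4 ∣ N` — the single dyadic regime `v₂(N) ≥ 4` where the half-translate symmetry `T_{1/2}` acts on
`S₂(Γ₀(N))^{2-new}` (the regime of the tree's THEOREM I / THEOREM A and of p2's u-family). -/
def ManinOddAtSixteen : Prop :=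
  mazur_not_dvd_maninConstant_of_odd → abbesUllmo_not_dvd_maninConstant_of_not_dvd_level →
  cesnavicius_not_two_dvd_maninConstant_of_two_dvd_level → exists_isNewformOf →
  ∀ (W : WeierstrassCurve ℚ) [W.IsElliptic] [W.IsGloballyMinimal] {N : ℕ} [NeZero N]
    (D : ModularParametrizationData W N),
    (∀ z ∈ D.L.lattice, ∃ w ∈ periodLattice D.f, z = D.c * w) → 2 ^ 4 ∣ N → ¬ (2 : ℤ) ∣ D.maninConstant

/-- **`ManinOddAtEight ⟸ ManinOddAtSixteen ∧ S-an-60`** (kernel-checked reduction; level pinned to the conductor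
by `IsNewformOf.level_eq_level`, then the `8 ∥ N ⇝ 2N` partner). -/
theorem maninOddAtEight_of_maninOddAtSixteen (h60 : NegOneTwistConductorTwoMul) (h16 : ManinOddAtSixteen) :
    ManinOddAtEight := by
  intro hMz hAU hCs hnf W _ _ N _ D hD h8
  haveI : NeZero (W.conductorNorm ℤ) := ⟨(W.conductorNorm_pos_holds).ne'⟩
  obtain ⟨g, hg⟩ := hnf W
  have hN : N = W.conductorNorm ℤ := IsNewformOf.level_eq_level D.isNewformOf hg
  subst hN
  refine two_not_dvd_c_of_eight_dvd_of_sixteen_dvd_stratum_of_modularity hnf h60 ?_ W D hD h8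
  intro W' _ _ _ D' hD' h16'
  exact h16 hMz hAU hCs hnf W' D' hD' h16'

/-- **THE ROUTE CRUX C2 REDUCED TO ITS `16 ∣ N` STRATUM**:
`NegOneTwistConductorFourMul → NegOneTwistConductorTwoMul → ManinOddAtSixteen → ManinOddAtFour`
(the conclusion is the route decl `Summit.BirchSwinnertonDyer.BirchSwinnertonDyer.Theses.ManinLocalTwoThree.ManinOddAtFour`). -/
theorem maninOddAtFour_of_maninOddAtSixteen (h58 : NegOneTwistConductorFourMul)
    (h60 : NegOneTwistConductorTwoMul) (h16 : ManinOddAtSixteen) :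
    Summit.BirchSwinnertonDyer.BirchSwinnertonDyer.Theses.ManinLocalTwoThree.ManinOddAtFour :=
  maninOddAtFour_of_maninOddAtEight h58 (maninOddAtEight_of_maninOddAtSixteen h60 h16)

/-- Converse: `ManinOddAtFour → ManinOddAtSixteen` (trivial), so C2 ⟺ `ManinOddAtSixteen ∧ S-an-58 ∧ S-an-60`
modulo the two print conductor facts. -/
theorem maninOddAtSixteen_of_maninOddAtFour
    (h : Summit.BirchSwinnertonDyer.BirchSwinnertonDyer.Theses.ManinLocalTwoThree.ManinOddAtFour) :
    ManinOddAtSixteen :=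
  fun hMz hAU hCs hnf W _ _ _N _ D hD h16 ↦
    h hMz hAU hCs hnf W D hD (dvd_trans ⟨4, by norm_num⟩ h16)

end SplitSixteen

end Summit.BirchSwinnertonDyer.Rank1Residual.ManinAdditive

end
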